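import Summits.ValiantsHypothesis.ValiantsHypothesis.Theorems.LacunarySymmetroidMatrixDescartesCensusDoorA34ConfluentNine
import Summits.ValiantsHypothesis.ValiantsHypothesis.Theorems.LacunarySymmetroidMatrixDescartesCensusDoorA34ConfluentNineTable

/-!
# `MatrixDescartes` census — DOOR A at `(3,4)`: THE CONFLUENT NINE, part 4 — NEWTON CERTIFICATES: no ninefold root at all in
# chamber I (`d₂ > 3d₁`, symmetric middle letter) and in chamber III up to `10d₂ ≤ 19d₁` (symmetric letters), for EVERY such support

HONEST FRAMING.  Object-search cell `pub-symmetroid`, door-A seat `val-sym-door-p3` (g25); helper file beside the OPEN typed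
statement `DoorA34 = PosRootLawAt 3 4 18` (route item `Theses.LacunarySymmetroid.DoorA34`, stmt-ValiantsHypothesis-19980),
asserted nowhere here.  Parts 1–3: `…ConfluentNineKernel` (confluent Vandermonde kernel, ten-term expansion), `…ConfluentNine`
(slope formula; chambers II/IV: the coalesced nine is a pseudoline contact), `…ConfluentNineTable` (confluent coefficient table,
Newton's inequality).  Here the two remaining chambers:

* **`not_ninefold_root_chamber_I`** (ALL supports with `0 < d₁`, `3d₁ < d₂`; `S₁` symmetric, `S₂` ARBITRARY; any `x₀`):
  `(X − x₀)⁹ ∤ det(1 + X^{d₁}S₁ + X^{d₂}S₂)` — the table violates Newton's inequality for the single letter `S₁`: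
  `(e₂(S₁)² − 3 tr S₁ det S₁)·(m₁m₃m₆)² = m₁m₆·W₁`, `W₁ = −135·d₁²d₂⁴(d₂−d₁)⁴(d₁+d₂)(d₂−2d₁)(2d₂−d₁)(2d₁+d₂)²(d₁+2d₂)²(7d₁²−25d₁d₂+13d₂²) < 0`.
  (The definite-TOP twin on the single support `(0,1,4)` is eng-2's `NoNinefold.not_ninefold_root`.)
* **`not_ninefold_root_chamber_III`** (ALL supports with `3d₁ < 2d₂`, `10d₂ ≤ 19d₁`; both letters symmetric; any `x₀`): Newton's
  inequality fails for `N = d₁·x₀^{d₁}S₁ + (6d₁ − 4d₂)·x₀^{d₂}S₂`: `(e₂(N)² − 3e₁(N)e₃(N))·(L₁L₂L₃)² = L₁L₃·W₃` with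
  `W₃ = 135·d₁⁴d₂²(d₂−d₁)⁴(d₂−2d₁)²(2d₂−d₁)²(2d₂−3d₁)²(3d₂−2d₁)(2d₁+d₂)(d₁+2d₂)·R₁₁(d₁,d₂)` and the degree-11 form `R₁₁ < 0` on that
  range by the certificate `2²⁸R₁₁(d₁,d₂) = −Q(2d₂ − 3d₁, 19d₁ − 10d₂)`, `Q` a form with POSITIVE integer coefficients.  Since in
  chamber III the coalesced nine would be a λ_min-contact (`confluent_slope_formula > 0` there), this is the Claim-L-relevant
  exclusion; the sliver `19d₁ < 10d₂ < 20d₁` next to the wall `d₂ = 2d₁` is NOT covered (there only the full discriminant fails,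
  thinly — eng-2's exact table; not typed).

With parts 2–4: for every support except that sliver, the multiplicity-`9` stratum of `(3,3)` rows with identity bottom letter and
symmetric letters is EMPTY (chambers I, III₁₉) or a pseudoline contact (II, IV).  Nothing here bounds `ζ_sym(3,3)` or `ζ_sym(3,4)`
(«no 9-fold contact does not by itself bound the count»); `DoorA34`, Claim L and `MatrixDescartes` (stmt-ValiantsHypothesis-18050)
stay OPEN; registers unchanged; nothing on `VP ≠ VNP`.
[folklore] Newton's inequalities for real-rooted cubics; certificates by `ring` / `linear_combination` / `positivity`.
-/

-- `Summit.ValiantsHypothesis.ValiantsHypothesis.…` repeats a component by the D-0017 layout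
-- (single-conjunct summit), which the `dupNamespace` linter flags; the name is mandated.
set_option linter.dupNamespace false

namespace Summit.ValiantsHypothesis.ValiantsHypothesis.Theorems.LacunarySymmetroidMatrixDescartes.Census.ConfluentNine

open Polynomial Finset
open scoped BigOperators

/-! ## 4. Chamber I: Newton's inequality fails for the middle letter alone -/

/-- **NO NINEFOLD ROOT IN CHAMBER I (all supports `d₂ > 3d₁`).**  For ANY support with `0 < d₁`, `3d₁ < d₂`, any real SYMMETRIC
middle letter `S₁`, ANY real top letter `S₂` and any `x₀`, the determinant of `1 + X^{d₁}S₁ + X^{d₂}S₂` is not divisible by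
`(X − x₀)⁹`: the confluent coefficient table forces `e₂(S₁)² − 3·tr S₁·det S₁ < 0`, against Newton's inequality for the real spectrum
of `S₁`.  (The definite-TOP twin on `(0,1,4)` is eng-2's `NoNinefold.not_ninefold_root`; this is the definite-BOTTOM law on the whole
chamber.) [folklore] -/
theorem not_ninefold_root_chamber_I (d₁ d₂ : ℕ) (S₁ S₂ : Matrix (Fin 3) (Fin 3) ℝ) (h0 : 0 < d₁) (hI : 3 * d₁ < d₂)
    (hS₁ : S₁.IsSymm) (x₀ : ℝ) :
    ¬ (X - C x₀) ^ 9 ∣ (∑ l, (X : ℝ[X]) ^ (![0, d₁, d₂] : Fin 3 → ℕ) l • ((![1, S₁, S₂] : Fin 3 → Matrix (Fin 3) (Fin 3) ℝ) l).map C).det := by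
  intro h9
  have h := dvd_comp_scale h9
  rw [det_pencil_comp_scale] at h
  have hT : (x₀ ^ d₁ • S₁).IsSymm := hS₁.smul _
  obtain ⟨C1, -, C3, -, -, C6, -, -, -⟩ := confluent_coefficients d₁ d₂ (x₀ ^ d₁ • S₁) (x₀ ^ d₂ • S₂) h0 (by omega) h
  have hN := newton_two_of_isSymm (x₀ ^ d₁ • S₁) hT
  have ha : (0 : ℝ) < d₁ := by exact_mod_cast h0
  have hI' : 3 * (d₁ : ℝ) < d₂ := by exact_mod_cast hI
  have p1 : 0 < (d₂ : ℝ) - (d₁ : ℝ) := by linarith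
  have p2 : 0 < (d₂ : ℝ) - 2 * (d₁ : ℝ) := by linarith
  have p3 : 0 < (d₂ : ℝ) - 3 * (d₁ : ℝ) := by linarith
  have p4 : 0 < 2 * (d₂ : ℝ) - (d₁ : ℝ) := by linarith
  have p5 : 0 < 2 * (d₂ : ℝ) - 3 * (d₁ : ℝ) := by linarith
  have p6 : 0 < 3 * (d₂ : ℝ) - (d₁ : ℝ) := by linarith
  have p7 : 0 < (d₂ : ℝ) := by linarith
  have p8 : 0 < (d₁ : ℝ) + (d₂ : ℝ) := by linarith
  have p9 : 0 < 2 * (d₁ : ℝ) + (d₂ : ℝ) := by linarith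
  have p10 : 0 < (d₁ : ℝ) + 2 * (d₂ : ℝ) := by linarith
  have hq : 0 < 7 * (d₁ : ℝ) ^ 2 - 25 * (d₁ : ℝ) * (d₂ : ℝ) + 13 * (d₂ : ℝ) ^ 2 := by nlinarith [mul_pos ha p3, sq_nonneg ((d₂ : ℝ) - 3 * (d₁ : ℝ))]
  set T : Matrix (Fin 3) (Fin 3) ℝ := (x₀ ^ d₁ • S₁) with hT_def
  have key : ((T 0 0 * T 1 1 - T 0 1 * T 1 0 + (T 0 0 * T 2 2 - T 0 2 * T 2 0) + (T 1 1 * T 2 2 - T 1 2 * T 2 1)) ^ 2 - 3 * T.trace * T.det)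
      * ((((d₂ : ℝ) - (d₁ : ℝ)) * (2 * (d₂ : ℝ) - (d₁ : ℝ)) * (3 * (d₂ : ℝ) - (d₁ : ℝ))) * (((d₂ : ℝ) - (d₁ : ℝ)) ^ 2 * ((d₂ : ℝ) - 2 * (d₁ : ℝ))
      * (2 * (d₂ : ℝ) - (d₁ : ℝ)) * (3 * (d₂ : ℝ) - 2 * (d₁ : ℝ))) * (((d₂ : ℝ) - (d₁ : ℝ)) ^ 3 * ((d₂ : ℝ) - 2 * (d₁ : ℝ)) * ((d₂ : ℝ) - 3
      * (d₁ : ℝ)) * (2 * (d₂ : ℝ) - 3 * (d₁ : ℝ)))) ^ 2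
      = ((((d₂ : ℝ) - (d₁ : ℝ)) * (2 * (d₂ : ℝ) - (d₁ : ℝ)) * (3 * (d₂ : ℝ) - (d₁ : ℝ))) * (((d₂ : ℝ) - (d₁ : ℝ)) ^ 3 * ((d₂ : ℝ) - 2 * (d₁ : ℝ))
          * ((d₂ : ℝ) - 3 * (d₁ : ℝ)) * (2 * (d₂ : ℝ) - 3 * (d₁ : ℝ)))) * (-135 * (d₁ : ℝ) ^ 2 * (d₂ : ℝ) ^ 4 * ((d₂ : ℝ) - (d₁ : ℝ)) ^ 4
          * ((d₁ : ℝ) + (d₂ : ℝ)) * ((d₂ : ℝ) - 2 * (d₁ : ℝ)) * (2 * (d₂ : ℝ) - (d₁ : ℝ)) * (2 * (d₁ : ℝ) + (d₂ : ℝ)) ^ 2 * ((d₁ : ℝ) + 2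
          * (d₂ : ℝ)) ^ 2 * (7 * (d₁ : ℝ) ^ 2 - 25 * (d₁ : ℝ) * (d₂ : ℝ) + 13 * (d₂ : ℝ) ^ 2)) := by
    linear_combination ((T 0 0 * T 1 1 - T 0 1 * T 1 0 + (T 0 0 * T 2 2 - T 0 2 * T 2 0) + (T 1 1 * T 2 2 - T 1 2 * T 2 1)) * (((d₂ : ℝ)
        - (d₁ : ℝ)) ^ 2 * ((d₂ : ℝ) - 2 * (d₁ : ℝ)) * (2 * (d₂ : ℝ) - (d₁ : ℝ)) * (3 * (d₂ : ℝ) - 2 * (d₁ : ℝ))) + (9 * (d₂ : ℝ) ^ 2 * ((d₂ : ℝ)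
        + (d₁ : ℝ)) * ((d₂ : ℝ) + 2 * (d₁ : ℝ)) * (2 * (d₂ : ℝ) + (d₁ : ℝ)))) * ((((d₂ : ℝ) - (d₁ : ℝ)) * (2 * (d₂ : ℝ) - (d₁ : ℝ)) * (3 * (d₂ : ℝ)
        - (d₁ : ℝ))) * (((d₂ : ℝ) - (d₁ : ℝ)) ^ 3 * ((d₂ : ℝ) - 2 * (d₁ : ℝ)) * ((d₂ : ℝ) - 3 * (d₁ : ℝ)) * (2 * (d₂ : ℝ) - 3 * (d₁ : ℝ)))) ^ 2 * C3
      - 3 * ((((d₂ : ℝ) - (d₁ : ℝ)) * (2 * (d₂ : ℝ) - (d₁ : ℝ)) * (3 * (d₂ : ℝ) - (d₁ : ℝ))) * (((d₂ : ℝ) - (d₁ : ℝ)) ^ 3 * ((d₂ : ℝ) - 2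
          * (d₁ : ℝ)) * ((d₂ : ℝ) - 3 * (d₁ : ℝ)) * (2 * (d₂ : ℝ) - 3 * (d₁ : ℝ)))) * (((d₂ : ℝ) - (d₁ : ℝ)) ^ 2 * ((d₂ : ℝ) - 2 * (d₁ : ℝ)) * (2
          * (d₂ : ℝ) - (d₁ : ℝ)) * (3 * (d₂ : ℝ) - 2 * (d₁ : ℝ))) ^ 2 * (T.det * (((d₂ : ℝ) - (d₁ : ℝ)) ^ 3 * ((d₂ : ℝ) - 2 * (d₁ : ℝ)) * ((d₂ : ℝ)
          - 3 * (d₁ : ℝ)) * (2 * (d₂ : ℝ) - 3 * (d₁ : ℝ)))) * C1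
      - 3 * ((((d₂ : ℝ) - (d₁ : ℝ)) * (2 * (d₂ : ℝ) - (d₁ : ℝ)) * (3 * (d₂ : ℝ) - (d₁ : ℝ))) * (((d₂ : ℝ) - (d₁ : ℝ)) ^ 3 * ((d₂ : ℝ) - 2
          * (d₁ : ℝ)) * ((d₂ : ℝ) - 3 * (d₁ : ℝ)) * (2 * (d₂ : ℝ) - 3 * (d₁ : ℝ)))) * (((d₂ : ℝ) - (d₁ : ℝ)) ^ 2 * ((d₂ : ℝ) - 2 * (d₁ : ℝ)) * (2
          * (d₂ : ℝ) - (d₁ : ℝ)) * (3 * (d₂ : ℝ) - 2 * (d₁ : ℝ))) ^ 2 * (-9 * (d₂ : ℝ) * ((d₂ : ℝ) + 2 * (d₁ : ℝ)) * (2 * (d₂ : ℝ) + (d₁ : ℝ))) * C6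
  have hnn : 0 ≤ ((T 0 0 * T 1 1 - T 0 1 * T 1 0 + (T 0 0 * T 2 2 - T 0 2 * T 2 0) + (T 1 1 * T 2 2 - T 1 2 * T 2 1)) ^ 2 - 3 * T.trace * T.det)
      * ((((d₂ : ℝ) - (d₁ : ℝ)) * (2 * (d₂ : ℝ) - (d₁ : ℝ)) * (3 * (d₂ : ℝ) - (d₁ : ℝ))) * (((d₂ : ℝ) - (d₁ : ℝ)) ^ 2 * ((d₂ : ℝ) - 2 * (d₁ : ℝ))
      * (2 * (d₂ : ℝ) - (d₁ : ℝ)) * (3 * (d₂ : ℝ) - 2 * (d₁ : ℝ))) * (((d₂ : ℝ) - (d₁ : ℝ)) ^ 3 * ((d₂ : ℝ) - 2 * (d₁ : ℝ)) * ((d₂ : ℝ) - 3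
      * (d₁ : ℝ)) * (2 * (d₂ : ℝ) - 3 * (d₁ : ℝ)))) ^ 2 :=
    mul_nonneg (sub_nonneg.mpr hN) (sq_nonneg _)
  have hneg : ((((d₂ : ℝ) - (d₁ : ℝ)) * (2 * (d₂ : ℝ) - (d₁ : ℝ)) * (3 * (d₂ : ℝ) - (d₁ : ℝ))) * (((d₂ : ℝ) - (d₁ : ℝ)) ^ 3 * ((d₂ : ℝ) - 2
      * (d₁ : ℝ)) * ((d₂ : ℝ) - 3 * (d₁ : ℝ)) * (2 * (d₂ : ℝ) - 3 * (d₁ : ℝ)))) * (-135 * (d₁ : ℝ) ^ 2 * (d₂ : ℝ) ^ 4 * ((d₂ : ℝ) - (d₁ : ℝ)) ^ 4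
      * ((d₁ : ℝ) + (d₂ : ℝ)) * ((d₂ : ℝ) - 2 * (d₁ : ℝ)) * (2 * (d₂ : ℝ) - (d₁ : ℝ)) * (2 * (d₁ : ℝ) + (d₂ : ℝ)) ^ 2 * ((d₁ : ℝ) + 2
      * (d₂ : ℝ)) ^ 2 * (7 * (d₁ : ℝ) ^ 2 - 25 * (d₁ : ℝ) * (d₂ : ℝ) + 13 * (d₂ : ℝ) ^ 2)) < 0 := by
    have hm : 0 < (((d₂ : ℝ) - (d₁ : ℝ)) * (2 * (d₂ : ℝ) - (d₁ : ℝ)) * (3 * (d₂ : ℝ) - (d₁ : ℝ))) * (((d₂ : ℝ) - (d₁ : ℝ)) ^ 3 * ((d₂ : ℝ) - 2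
        * (d₁ : ℝ)) * ((d₂ : ℝ) - 3 * (d₁ : ℝ)) * (2 * (d₂ : ℝ) - 3 * (d₁ : ℝ))) := by positivity
    have hw : (-135 * (d₁ : ℝ) ^ 2 * (d₂ : ℝ) ^ 4 * ((d₂ : ℝ) - (d₁ : ℝ)) ^ 4 * ((d₁ : ℝ) + (d₂ : ℝ)) * ((d₂ : ℝ) - 2 * (d₁ : ℝ)) * (2 * (d₂ : ℝ)
        - (d₁ : ℝ)) * (2 * (d₁ : ℝ) + (d₂ : ℝ)) ^ 2 * ((d₁ : ℝ) + 2 * (d₂ : ℝ)) ^ 2 * (7 * (d₁ : ℝ) ^ 2 - 25 * (d₁ : ℝ) * (d₂ : ℝ) + 13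
        * (d₂ : ℝ) ^ 2)) < 0 := by
      have : 0 < 135 * (d₁ : ℝ) ^ 2 * (d₂ : ℝ) ^ 4 * ((d₂ : ℝ) - (d₁ : ℝ)) ^ 4 * ((d₁ : ℝ) + (d₂ : ℝ)) * ((d₂ : ℝ) - 2 * (d₁ : ℝ)) * (2 * (d₂ : ℝ)
          - (d₁ : ℝ)) * (2 * (d₁ : ℝ) + (d₂ : ℝ)) ^ 2 * ((d₁ : ℝ) + 2 * (d₂ : ℝ)) ^ 2
          * (7 * (d₁ : ℝ) ^ 2 - 25 * (d₁ : ℝ) * (d₂ : ℝ) + 13 * (d₂ : ℝ) ^ 2) := by positivity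
      linarith
    exact mul_neg_of_pos_of_neg hm hw
  rw [key] at hnn
  exact absurd hnn (not_le.mpr hneg)

/-! ## 5. Chamber III up to `10d₂ ≤ 19d₁`: Newton's inequality fails for `N = d₁S₁ + (6d₁ − 4d₂)S₂` -/

/-- **NO NINEFOLD ROOT IN CHAMBER III up to `10d₂ ≤ 19d₁` (all such supports).**  For ANY support with `3d₁ < 2d₂` and
`10d₂ ≤ 19d₁`, any real SYMMETRIC letters `S₁, S₂` and any `x₀`, `(X − x₀)⁹ ∤ det(1 + X^{d₁}S₁ + X^{d₂}S₂)`: the confluent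
coefficient table makes the symmetric matrix `N = d₁·x₀^{d₁}S₁ + (6d₁ − 4d₂)·x₀^{d₂}S₂` violate Newton's inequality
`3e₁e₃ ≤ e₂²` — `e₂(N)² − 3e₁(N)e₃(N) = 135·(positive)·R₁₁/(…)` with the degree-11 form `R₁₁(d₁,d₂) < 0` certified by
`2²⁸R₁₁ = −Q(2d₂ − 3d₁, 19d₁ − 10d₂)`, `Q` a form with positive coefficients.  (In chamber III the coalesced nine would be a
λ_min-contact — `confluent_slope_formula` is positive there — so this IS the Claim-L-relevant exclusion; the sliver
`19d₁ < 10d₂ < 20d₁` is not covered.) [folklore] -/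
theorem not_ninefold_root_chamber_III (d₁ d₂ : ℕ) (S₁ S₂ : Matrix (Fin 3) (Fin 3) ℝ) (hlo : 3 * d₁ < 2 * d₂)
    (hhi : 10 * d₂ ≤ 19 * d₁) (hS₁ : S₁.IsSymm) (hS₂ : S₂.IsSymm) (x₀ : ℝ) :
    ¬ (X - C x₀) ^ 9 ∣ (∑ l, (X : ℝ[X]) ^ (![0, d₁, d₂] : Fin 3 → ℕ) l • ((![1, S₁, S₂] : Fin 3 → Matrix (Fin 3) (Fin 3) ℝ) l).map C).det := by
  intro h9
  have h := dvd_comp_scale h9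
  rw [det_pencil_comp_scale] at h
  have h0 : 0 < d₁ := by omega
  obtain ⟨C1, C2, C3, C4, C5, C6, C7, C8, C9⟩ := confluent_coefficients d₁ d₂ (x₀ ^ d₁ • S₁) (x₀ ^ d₂ • S₂) h0 (by omega) h
  have ha : (0 : ℝ) < d₁ := by exact_mod_cast h0
  have hlo' : 3 * (d₁ : ℝ) < 2 * d₂ := by exact_mod_cast hlo
  have hhi' : 10 * (d₂ : ℝ) ≤ 19 * d₁ := by exact_mod_cast hhi
  have p1 : 0 < (d₂ : ℝ) - (d₁ : ℝ) := by linarith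
  have q2 : (d₂ : ℝ) - 2 * (d₁ : ℝ) < 0 := by linarith
  have q3 : (d₂ : ℝ) - 3 * (d₁ : ℝ) < 0 := by linarith
  have n2 : (d₂ : ℝ) - 2 * (d₁ : ℝ) ≠ 0 := q2.ne
  have n3 : (d₂ : ℝ) - 3 * (d₁ : ℝ) ≠ 0 := q3.ne
  have p4 : 0 < 2 * (d₂ : ℝ) - (d₁ : ℝ) := by linarith
  have p5 : 0 < 2 * (d₂ : ℝ) - 3 * (d₁ : ℝ) := by linarith
  have p6 : 0 < 3 * (d₂ : ℝ) - (d₁ : ℝ) := by linarith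
  have p6' : 0 < 3 * (d₂ : ℝ) - 2 * (d₁ : ℝ) := by linarith
  have p7 : 0 < (d₂ : ℝ) := by linarith
  have p9 : 0 < 2 * (d₁ : ℝ) + (d₂ : ℝ) := by linarith
  have p10 : 0 < (d₁ : ℝ) + 2 * (d₂ : ℝ) := by linarith
  -- the certificate for R₁₁ < 0
  obtain ⟨u, hu⟩ : ∃ u : ℝ, u = 2 * (d₂ : ℝ) - 3 * (d₁ : ℝ) := ⟨_, rfl⟩
  obtain ⟨v, hv⟩ : ∃ v : ℝ, v = 19 * (d₁ : ℝ) - 10 * (d₂ : ℝ) := ⟨_, rfl⟩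
  have hu0 : 0 < u := by rw [hu]; linarith
  have hv0 : 0 ≤ v := by rw [hv]; linarith
  have hQ : 0 < (4729053771810) * u ^ 11 + (34044448898367) * u ^ 10 * v + (44804292551392) * u ^ 9 * v ^ 2 + (27696531097415) * u ^ 8 * v ^ 3
      + (10017095842924) * u ^ 7 * v ^ 4 + (2320652382302) * u ^ 6 * v ^ 5 + (358436042568) * u ^ 5 * v ^ 6 + (37310352550) * u ^ 4 * v ^ 7
      + (2582395906) * u ^ 3 * v ^ 8 + (113858371) * u ^ 2 * v ^ 9 + (2903880) * u * v ^ 10 + (33075) * v ^ 11 := by positivity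
  have hR : (2 : ℝ) ^ 28 * ((265680) * (d₁ : ℝ) ^ 11 + (-3400608) * (d₁ : ℝ) ^ 10 * (d₂ : ℝ) + (16131194) * (d₁ : ℝ) ^ 9 * (d₂ : ℝ) ^ 2
      + (-39771869) * (d₁ : ℝ) ^ 8 * (d₂ : ℝ) ^ 3 + (57142416) * (d₁ : ℝ) ^ 7 * (d₂ : ℝ) ^ 4 + (-48885943) * (d₁ : ℝ) ^ 6 * (d₂ : ℝ) ^ 5
      + (22866293) * (d₁ : ℝ) ^ 5 * (d₂ : ℝ) ^ 6 + (-3042346) * (d₁ : ℝ) ^ 4 * (d₂ : ℝ) ^ 7 + (-2381811) * (d₁ : ℝ) ^ 3 * (d₂ : ℝ) ^ 8 + (1315786)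
      * (d₁ : ℝ) ^ 2 * (d₂ : ℝ) ^ 9 + (-255952) * (d₁ : ℝ) * (d₂ : ℝ) ^ 10 + (16800) * (d₂ : ℝ) ^ 11) = -((4729053771810) * u ^ 11
      + (34044448898367) * u ^ 10 * v + (44804292551392) * u ^ 9 * v ^ 2 + (27696531097415) * u ^ 8 * v ^ 3 + (10017095842924) * u ^ 7 * v ^ 4
      + (2320652382302) * u ^ 6 * v ^ 5 + (358436042568) * u ^ 5 * v ^ 6 + (37310352550) * u ^ 4 * v ^ 7 + (2582395906) * u ^ 3 * v ^ 8
      + (113858371) * u ^ 2 * v ^ 9 + (2903880) * u * v ^ 10 + (33075) * v ^ 11) := by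
    rw [hu, hv]; ring
  have hRneg : (265680) * (d₁ : ℝ) ^ 11 + (-3400608) * (d₁ : ℝ) ^ 10 * (d₂ : ℝ) + (16131194) * (d₁ : ℝ) ^ 9 * (d₂ : ℝ) ^ 2 + (-39771869)
      * (d₁ : ℝ) ^ 8 * (d₂ : ℝ) ^ 3 + (57142416) * (d₁ : ℝ) ^ 7 * (d₂ : ℝ) ^ 4 + (-48885943) * (d₁ : ℝ) ^ 6 * (d₂ : ℝ) ^ 5 + (22866293)
      * (d₁ : ℝ) ^ 5 * (d₂ : ℝ) ^ 6 + (-3042346) * (d₁ : ℝ) ^ 4 * (d₂ : ℝ) ^ 7 + (-2381811) * (d₁ : ℝ) ^ 3 * (d₂ : ℝ) ^ 8 + (1315786)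
      * (d₁ : ℝ) ^ 2 * (d₂ : ℝ) ^ 9 + (-255952) * (d₁ : ℝ) * (d₂ : ℝ) ^ 10 + (16800) * (d₂ : ℝ) ^ 11 < 0 := by
    have h28 : (0 : ℝ) ≤ 2 ^ 28 := by positivity
    refine lt_of_not_ge fun hc => ?_
    have hm := mul_nonneg h28 hc
    rw [hR] at hm
    linarith
  have hLL : 0 < (((d₂ : ℝ) - (d₁ : ℝ)) * (2 * (d₂ : ℝ) - (d₁ : ℝ)) * (3 * (d₂ : ℝ) - (d₁ : ℝ)) * ((d₂ : ℝ) - 2 * (d₁ : ℝ)) * ((d₂ : ℝ) - 3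
      * (d₁ : ℝ))) * (((d₂ : ℝ) - (d₁ : ℝ)) ^ 3 * ((d₂ : ℝ) - 2 * (d₁ : ℝ)) * ((d₂ : ℝ) - 3 * (d₁ : ℝ)) * (2 * (d₂ : ℝ) - 3 * (d₁ : ℝ)) * (2
      * (d₂ : ℝ) - (d₁ : ℝ)) * (3 * (d₂ : ℝ) - (d₁ : ℝ)) * (3 * (d₂ : ℝ) - 2 * (d₁ : ℝ))) := by
    have e : (((d₂ : ℝ) - (d₁ : ℝ)) * (2 * (d₂ : ℝ) - (d₁ : ℝ)) * (3 * (d₂ : ℝ) - (d₁ : ℝ)) * ((d₂ : ℝ) - 2 * (d₁ : ℝ)) * ((d₂ : ℝ) - 3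
        * (d₁ : ℝ))) * (((d₂ : ℝ) - (d₁ : ℝ)) ^ 3 * ((d₂ : ℝ) - 2 * (d₁ : ℝ)) * ((d₂ : ℝ) - 3 * (d₁ : ℝ)) * (2 * (d₂ : ℝ) - 3 * (d₁ : ℝ)) * (2
        * (d₂ : ℝ) - (d₁ : ℝ)) * (3 * (d₂ : ℝ) - (d₁ : ℝ)) * (3 * (d₂ : ℝ) - 2 * (d₁ : ℝ))) = ((d₂ : ℝ) - (d₁ : ℝ)) ^ 4 * (2 * (d₂ : ℝ)
        - (d₁ : ℝ)) ^ 2 * (3 * (d₂ : ℝ) - (d₁ : ℝ)) ^ 2 * ((d₂ : ℝ) - 2 * (d₁ : ℝ)) ^ 2 * ((d₂ : ℝ) - 3 * (d₁ : ℝ)) ^ 2 * (2 * (d₂ : ℝ) - 3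
        * (d₁ : ℝ)) * (3 * (d₂ : ℝ) - 2 * (d₁ : ℝ)) := by ring
    rw [e]; positivity
  have hWneg : (135 * (d₁ : ℝ) ^ 4 * (d₂ : ℝ) ^ 2 * ((d₂ : ℝ) - (d₁ : ℝ)) ^ 4 * ((d₂ : ℝ) - 2 * (d₁ : ℝ)) ^ 2 * (2 * (d₂ : ℝ) - (d₁ : ℝ)) ^ 2 * (2
      * (d₂ : ℝ) - 3 * (d₁ : ℝ)) ^ 2 * (3 * (d₂ : ℝ) - 2 * (d₁ : ℝ)) * (2 * (d₁ : ℝ) + (d₂ : ℝ)) * ((d₁ : ℝ) + 2 * (d₂ : ℝ)) * ((265680)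
      * (d₁ : ℝ) ^ 11 + (-3400608) * (d₁ : ℝ) ^ 10 * (d₂ : ℝ) + (16131194) * (d₁ : ℝ) ^ 9 * (d₂ : ℝ) ^ 2 + (-39771869) * (d₁ : ℝ) ^ 8
      * (d₂ : ℝ) ^ 3 + (57142416) * (d₁ : ℝ) ^ 7 * (d₂ : ℝ) ^ 4 + (-48885943) * (d₁ : ℝ) ^ 6 * (d₂ : ℝ) ^ 5 + (22866293) * (d₁ : ℝ) ^ 5
      * (d₂ : ℝ) ^ 6 + (-3042346) * (d₁ : ℝ) ^ 4 * (d₂ : ℝ) ^ 7 + (-2381811) * (d₁ : ℝ) ^ 3 * (d₂ : ℝ) ^ 8 + (1315786) * (d₁ : ℝ) ^ 2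
      * (d₂ : ℝ) ^ 9 + (-255952) * (d₁ : ℝ) * (d₂ : ℝ) ^ 10 + (16800) * (d₂ : ℝ) ^ 11)) < 0 := by
    have : 0 < 135 * (d₁ : ℝ) ^ 4 * (d₂ : ℝ) ^ 2 * ((d₂ : ℝ) - (d₁ : ℝ)) ^ 4 * ((d₂ : ℝ) - 2 * (d₁ : ℝ)) ^ 2 * (2 * (d₂ : ℝ) - (d₁ : ℝ)) ^ 2 * (2
        * (d₂ : ℝ) - 3 * (d₁ : ℝ)) ^ 2 * (3 * (d₂ : ℝ) - 2 * (d₁ : ℝ)) * (2 * (d₁ : ℝ) + (d₂ : ℝ)) * ((d₁ : ℝ) + 2 * (d₂ : ℝ)) := by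
      positivity
    exact mul_neg_of_pos_of_neg this hRneg
  have hNsymm : (((d₁ : ℝ)) • (x₀ ^ d₁ • S₁) + (6 * (d₁ : ℝ) - 4 * (d₂ : ℝ)) • (x₀ ^ d₂ • S₂)).IsSymm := (hS₁.smul _).smul _ |>.add ((hS₂.smul _).smul _)
  have hN := newton_two_of_isSymm _ hNsymm
  set L₁ : ℝ := (((d₂ : ℝ) - (d₁ : ℝ)) * (2 * (d₂ : ℝ) - (d₁ : ℝ)) * (3 * (d₂ : ℝ) - (d₁ : ℝ)) * ((d₂ : ℝ) - 2 * (d₁ : ℝ)) * ((d₂ : ℝ) - 3 * (d₁ : ℝ))) with hL1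
  set L₂ : ℝ := (((d₂ : ℝ) - (d₁ : ℝ)) ^ 2 * ((d₂ : ℝ) - 2 * (d₁ : ℝ)) * (2 * (d₂ : ℝ) - (d₁ : ℝ)) * (3 * (d₂ : ℝ) - 2 * (d₁ : ℝ)) * (2 * (d₂ : ℝ)
      - 3 * (d₁ : ℝ))) with hL2
  set L₃ : ℝ := (((d₂ : ℝ) - (d₁ : ℝ)) ^ 3 * ((d₂ : ℝ) - 2 * (d₁ : ℝ)) * ((d₂ : ℝ) - 3 * (d₁ : ℝ)) * (2 * (d₂ : ℝ) - 3 * (d₁ : ℝ)) * (2 * (d₂ : ℝ)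
      - (d₁ : ℝ)) * (3 * (d₂ : ℝ) - (d₁ : ℝ)) * (3 * (d₂ : ℝ) - 2 * (d₁ : ℝ))) with hL3
  set P₁ : ℝ := ((d₁ : ℝ) * (-9 * (d₂ : ℝ) * ((d₂ : ℝ) + 2 * (d₁ : ℝ)) * (2 * (d₂ : ℝ) + (d₁ : ℝ))) * (((d₂ : ℝ) - 2 * (d₁ : ℝ)) * ((d₂ : ℝ) - 3
      * (d₁ : ℝ))) + (6 * (d₁ : ℝ) - 4 * (d₂ : ℝ)) * (9 * (d₁ : ℝ) * ((d₂ : ℝ) + 2 * (d₁ : ℝ)) * (2 * (d₂ : ℝ) + (d₁ : ℝ))) * ((2 * (d₂ : ℝ)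
      - (d₁ : ℝ)) * (3 * (d₂ : ℝ) - (d₁ : ℝ)))) with hP1
  set P₂ : ℝ := ((d₁ : ℝ) ^ 2 * (9 * (d₂ : ℝ) ^ 2 * ((d₂ : ℝ) + (d₁ : ℝ)) * ((d₂ : ℝ) + 2 * (d₁ : ℝ)) * (2 * (d₂ : ℝ) + (d₁ : ℝ))) * (2 * (d₂ : ℝ)
      - 3 * (d₁ : ℝ)) + (d₁ : ℝ) * (6 * (d₁ : ℝ) - 4 * (d₂ : ℝ)) * (-36 * (d₁ : ℝ) * (d₂ : ℝ) * ((d₂ : ℝ) + 2 * (d₁ : ℝ)) * (2 * (d₂ : ℝ)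
      + (d₁ : ℝ))) * ((3 * (d₂ : ℝ) - 2 * (d₁ : ℝ)) * (2 * (d₂ : ℝ) - 3 * (d₁ : ℝ))) + (6 * (d₁ : ℝ) - 4 * (d₂ : ℝ)) ^ 2 * (-9 * (d₁ : ℝ) ^ 2
      * ((d₂ : ℝ) + (d₁ : ℝ)) * ((d₂ : ℝ) + 2 * (d₁ : ℝ)) * (2 * (d₂ : ℝ) + (d₁ : ℝ))) * (3 * (d₂ : ℝ) - 2 * (d₁ : ℝ))) with hP2
  set P₃ : ℝ := ((d₁ : ℝ) ^ 3 * (-((d₂ : ℝ) ^ 3) * ((d₂ : ℝ) + (d₁ : ℝ)) * ((d₂ : ℝ) + 2 * (d₁ : ℝ)) * (2 * (d₂ : ℝ) + (d₁ : ℝ))) * ((2 * (d₂ : ℝ)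
      - (d₁ : ℝ)) * (3 * (d₂ : ℝ) - (d₁ : ℝ)) * (3 * (d₂ : ℝ) - 2 * (d₁ : ℝ))) + (d₁ : ℝ) ^ 2 * (6 * (d₁ : ℝ) - 4 * (d₂ : ℝ)) * (9 * (d₁ : ℝ)
      * (d₂ : ℝ) ^ 2 * (2 * (d₂ : ℝ) + (d₁ : ℝ))) * (((d₂ : ℝ) - 3 * (d₁ : ℝ)) * (2 * (d₂ : ℝ) - 3 * (d₁ : ℝ)) * (2 * (d₂ : ℝ) - (d₁ : ℝ)) * (3
      * (d₂ : ℝ) - (d₁ : ℝ)) * (3 * (d₂ : ℝ) - 2 * (d₁ : ℝ))) + (d₁ : ℝ) * (6 * (d₁ : ℝ) - 4 * (d₂ : ℝ)) ^ 2 * (9 * (d₁ : ℝ) ^ 2 * (d₂ : ℝ)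
      * ((d₂ : ℝ) + 2 * (d₁ : ℝ))) * (((d₂ : ℝ) - 2 * (d₁ : ℝ)) * ((d₂ : ℝ) - 3 * (d₁ : ℝ)) * (2 * (d₂ : ℝ) - 3 * (d₁ : ℝ)) * (3 * (d₂ : ℝ)
      - (d₁ : ℝ)) * (3 * (d₂ : ℝ) - 2 * (d₁ : ℝ))) + (6 * (d₁ : ℝ) - 4 * (d₂ : ℝ)) ^ 3 * (-((d₁ : ℝ) ^ 3) * ((d₂ : ℝ) + (d₁ : ℝ)) * ((d₂ : ℝ) + 2
      * (d₁ : ℝ)) * (2 * (d₂ : ℝ) + (d₁ : ℝ))) * (((d₂ : ℝ) - 2 * (d₁ : ℝ)) * ((d₂ : ℝ) - 3 * (d₁ : ℝ)) * (2 * (d₂ : ℝ) - 3 * (d₁ : ℝ)))) with hP3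
  have e1 : (((d₁ : ℝ)) • (x₀ ^ d₁ • S₁) + (6 * (d₁ : ℝ) - 4 * (d₂ : ℝ)) • (x₀ ^ d₂ • S₂)).trace * L₁ = P₁ := by
    simp only [Matrix.trace_smul, smul_eq_mul] at C1 C2
    simp only [Matrix.trace_add, Matrix.trace_smul, smul_eq_mul]
    rw [hL1, hP1]
    linear_combination ((d₁ : ℝ) * (((d₂ : ℝ) - 2 * (d₁ : ℝ)) * ((d₂ : ℝ) - 3 * (d₁ : ℝ)))) * C1 + ((6 * (d₁ : ℝ) - 4 * (d₂ : ℝ)) * ((2 * (d₂ : ℝ)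
        - (d₁ : ℝ)) * (3 * (d₂ : ℝ) - (d₁ : ℝ)))) * C2
  have e2 : ((((d₁ : ℝ)) • (x₀ ^ d₁ • S₁) + (6 * (d₁ : ℝ) - 4 * (d₂ : ℝ)) • (x₀ ^ d₂ • S₂)) 0 0 * (((d₁ : ℝ)) • (x₀ ^ d₁ • S₁) + (6 * (d₁ : ℝ) - 4
      * (d₂ : ℝ)) • (x₀ ^ d₂ • S₂)) 1 1 - (((d₁ : ℝ)) • (x₀ ^ d₁ • S₁) + (6 * (d₁ : ℝ) - 4 * (d₂ : ℝ)) • (x₀ ^ d₂ • S₂)) 0 1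
      * (((d₁ : ℝ)) • (x₀ ^ d₁ • S₁) + (6 * (d₁ : ℝ) - 4 * (d₂ : ℝ)) • (x₀ ^ d₂ • S₂)) 1 0 + ((((d₁ : ℝ)) • (x₀ ^ d₁ • S₁) + (6 * (d₁ : ℝ) - 4
      * (d₂ : ℝ)) • (x₀ ^ d₂ • S₂)) 0 0 * (((d₁ : ℝ)) • (x₀ ^ d₁ • S₁) + (6 * (d₁ : ℝ) - 4 * (d₂ : ℝ)) • (x₀ ^ d₂ • S₂)) 2 2
      - (((d₁ : ℝ)) • (x₀ ^ d₁ • S₁) + (6 * (d₁ : ℝ) - 4 * (d₂ : ℝ)) • (x₀ ^ d₂ • S₂)) 0 2 * (((d₁ : ℝ)) • (x₀ ^ d₁ • S₁) + (6 * (d₁ : ℝ) - 4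
      * (d₂ : ℝ)) • (x₀ ^ d₂ • S₂)) 2 0) + ((((d₁ : ℝ)) • (x₀ ^ d₁ • S₁) + (6 * (d₁ : ℝ) - 4 * (d₂ : ℝ)) • (x₀ ^ d₂ • S₂)) 1 1
      * (((d₁ : ℝ)) • (x₀ ^ d₁ • S₁) + (6 * (d₁ : ℝ) - 4 * (d₂ : ℝ)) • (x₀ ^ d₂ • S₂)) 2 2 - (((d₁ : ℝ)) • (x₀ ^ d₁ • S₁) + (6 * (d₁ : ℝ) - 4
      * (d₂ : ℝ)) • (x₀ ^ d₂ • S₂)) 1 2 * (((d₁ : ℝ)) • (x₀ ^ d₁ • S₁) + (6 * (d₁ : ℝ) - 4 * (d₂ : ℝ)) • (x₀ ^ d₂ • S₂)) 2 1)) * L₂ = P₂ := by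
    rw [e2_lin_comb, hL2, hP2]
    linear_combination ((d₁ : ℝ) ^ 2 * (2 * (d₂ : ℝ) - 3 * (d₁ : ℝ))) * C3 + ((d₁ : ℝ) * (6 * (d₁ : ℝ) - 4 * (d₂ : ℝ)) * ((3 * (d₂ : ℝ) - 2
        * (d₁ : ℝ)) * (2 * (d₂ : ℝ) - 3 * (d₁ : ℝ)))) * C4 + ((6 * (d₁ : ℝ) - 4 * (d₂ : ℝ)) ^ 2 * (3 * (d₂ : ℝ) - 2 * (d₁ : ℝ))) * C5
  have e3 : (((d₁ : ℝ)) • (x₀ ^ d₁ • S₁) + (6 * (d₁ : ℝ) - 4 * (d₂ : ℝ)) • (x₀ ^ d₂ • S₂)).det * L₃ = P₃ := by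
    rw [det_lin_comb, hL3, hP3]
    linear_combination ((d₁ : ℝ) ^ 3 * ((2 * (d₂ : ℝ) - (d₁ : ℝ)) * (3 * (d₂ : ℝ) - (d₁ : ℝ)) * (3 * (d₂ : ℝ) - 2 * (d₁ : ℝ)))) * C6
        + ((d₁ : ℝ) ^ 2 * (6 * (d₁ : ℝ) - 4 * (d₂ : ℝ)) * (((d₂ : ℝ) - 3 * (d₁ : ℝ)) * (2 * (d₂ : ℝ) - 3 * (d₁ : ℝ)) * (2 * (d₂ : ℝ) - (d₁ : ℝ))
        * (3 * (d₂ : ℝ) - (d₁ : ℝ)) * (3 * (d₂ : ℝ) - 2 * (d₁ : ℝ)))) * C7 + ((d₁ : ℝ) * (6 * (d₁ : ℝ) - 4 * (d₂ : ℝ)) ^ 2 * (((d₂ : ℝ) - 2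
        * (d₁ : ℝ)) * ((d₂ : ℝ) - 3 * (d₁ : ℝ)) * (2 * (d₂ : ℝ) - 3 * (d₁ : ℝ)) * (3 * (d₂ : ℝ) - (d₁ : ℝ)) * (3 * (d₂ : ℝ) - 2 * (d₁ : ℝ)))) * C8
      + ((6 * (d₁ : ℝ) - 4 * (d₂ : ℝ)) ^ 3 * (((d₂ : ℝ) - 2 * (d₁ : ℝ)) * ((d₂ : ℝ) - 3 * (d₁ : ℝ)) * (2 * (d₂ : ℝ) - 3 * (d₁ : ℝ)))) * C9
  have key : (((((d₁ : ℝ)) • (x₀ ^ d₁ • S₁) + (6 * (d₁ : ℝ) - 4 * (d₂ : ℝ)) • (x₀ ^ d₂ • S₂)) 0 0 * (((d₁ : ℝ)) • (x₀ ^ d₁ • S₁) + (6 * (d₁ : ℝ)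
      - 4 * (d₂ : ℝ)) • (x₀ ^ d₂ • S₂)) 1 1 - (((d₁ : ℝ)) • (x₀ ^ d₁ • S₁) + (6 * (d₁ : ℝ) - 4 * (d₂ : ℝ)) • (x₀ ^ d₂ • S₂)) 0 1
      * (((d₁ : ℝ)) • (x₀ ^ d₁ • S₁) + (6 * (d₁ : ℝ) - 4 * (d₂ : ℝ)) • (x₀ ^ d₂ • S₂)) 1 0 + ((((d₁ : ℝ)) • (x₀ ^ d₁ • S₁) + (6 * (d₁ : ℝ) - 4
      * (d₂ : ℝ)) • (x₀ ^ d₂ • S₂)) 0 0 * (((d₁ : ℝ)) • (x₀ ^ d₁ • S₁) + (6 * (d₁ : ℝ) - 4 * (d₂ : ℝ)) • (x₀ ^ d₂ • S₂)) 2 2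
      - (((d₁ : ℝ)) • (x₀ ^ d₁ • S₁) + (6 * (d₁ : ℝ) - 4 * (d₂ : ℝ)) • (x₀ ^ d₂ • S₂)) 0 2 * (((d₁ : ℝ)) • (x₀ ^ d₁ • S₁) + (6 * (d₁ : ℝ) - 4
      * (d₂ : ℝ)) • (x₀ ^ d₂ • S₂)) 2 0) + ((((d₁ : ℝ)) • (x₀ ^ d₁ • S₁) + (6 * (d₁ : ℝ) - 4 * (d₂ : ℝ)) • (x₀ ^ d₂ • S₂)) 1 1
      * (((d₁ : ℝ)) • (x₀ ^ d₁ • S₁) + (6 * (d₁ : ℝ) - 4 * (d₂ : ℝ)) • (x₀ ^ d₂ • S₂)) 2 2 - (((d₁ : ℝ)) • (x₀ ^ d₁ • S₁) + (6 * (d₁ : ℝ) - 4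
      * (d₂ : ℝ)) • (x₀ ^ d₂ • S₂)) 1 2 * (((d₁ : ℝ)) • (x₀ ^ d₁ • S₁) + (6 * (d₁ : ℝ) - 4 * (d₂ : ℝ)) • (x₀ ^ d₂ • S₂)) 2 1)) ^ 2
        - 3 * (((d₁ : ℝ)) • (x₀ ^ d₁ • S₁) + (6 * (d₁ : ℝ) - 4 * (d₂ : ℝ)) • (x₀ ^ d₂ • S₂)).trace * (((d₁ : ℝ)) • (x₀ ^ d₁ • S₁) + (6 * (d₁ : ℝ)
            - 4 * (d₂ : ℝ)) • (x₀ ^ d₂ • S₂)).det) * (L₁ * L₂ * L₃) ^ 2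
      = (L₁ * L₃) * (135 * (d₁ : ℝ) ^ 4 * (d₂ : ℝ) ^ 2 * ((d₂ : ℝ) - (d₁ : ℝ)) ^ 4 * ((d₂ : ℝ) - 2 * (d₁ : ℝ)) ^ 2 * (2 * (d₂ : ℝ) - (d₁ : ℝ)) ^ 2
          * (2 * (d₂ : ℝ) - 3 * (d₁ : ℝ)) ^ 2 * (3 * (d₂ : ℝ) - 2 * (d₁ : ℝ)) * (2 * (d₁ : ℝ) + (d₂ : ℝ)) * ((d₁ : ℝ) + 2 * (d₂ : ℝ)) * ((265680)
          * (d₁ : ℝ) ^ 11 + (-3400608) * (d₁ : ℝ) ^ 10 * (d₂ : ℝ) + (16131194) * (d₁ : ℝ) ^ 9 * (d₂ : ℝ) ^ 2 + (-39771869) * (d₁ : ℝ) ^ 8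
          * (d₂ : ℝ) ^ 3 + (57142416) * (d₁ : ℝ) ^ 7 * (d₂ : ℝ) ^ 4 + (-48885943) * (d₁ : ℝ) ^ 6 * (d₂ : ℝ) ^ 5 + (22866293) * (d₁ : ℝ) ^ 5
          * (d₂ : ℝ) ^ 6 + (-3042346) * (d₁ : ℝ) ^ 4 * (d₂ : ℝ) ^ 7 + (-2381811) * (d₁ : ℝ) ^ 3 * (d₂ : ℝ) ^ 8 + (1315786) * (d₁ : ℝ) ^ 2
          * (d₂ : ℝ) ^ 9 + (-255952) * (d₁ : ℝ) * (d₂ : ℝ) ^ 10 + (16800) * (d₂ : ℝ) ^ 11)) := by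
    linear_combination (norm := skip) ((L₁ * L₃) ^ 2 * (((((d₁ : ℝ)) • (x₀ ^ d₁ • S₁) + (6 * (d₁ : ℝ) - 4 * (d₂ : ℝ)) • (x₀ ^ d₂ • S₂)) 0 0
        * (((d₁ : ℝ)) • (x₀ ^ d₁ • S₁) + (6 * (d₁ : ℝ) - 4 * (d₂ : ℝ)) • (x₀ ^ d₂ • S₂)) 1 1 - (((d₁ : ℝ)) • (x₀ ^ d₁ • S₁) + (6 * (d₁ : ℝ) - 4
        * (d₂ : ℝ)) • (x₀ ^ d₂ • S₂)) 0 1 * (((d₁ : ℝ)) • (x₀ ^ d₁ • S₁) + (6 * (d₁ : ℝ) - 4 * (d₂ : ℝ)) • (x₀ ^ d₂ • S₂)) 1 0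
        + ((((d₁ : ℝ)) • (x₀ ^ d₁ • S₁) + (6 * (d₁ : ℝ) - 4 * (d₂ : ℝ)) • (x₀ ^ d₂ • S₂)) 0 0 * (((d₁ : ℝ)) • (x₀ ^ d₁ • S₁) + (6 * (d₁ : ℝ) - 4
        * (d₂ : ℝ)) • (x₀ ^ d₂ • S₂)) 2 2 - (((d₁ : ℝ)) • (x₀ ^ d₁ • S₁) + (6 * (d₁ : ℝ) - 4 * (d₂ : ℝ)) • (x₀ ^ d₂ • S₂)) 0 2
        * (((d₁ : ℝ)) • (x₀ ^ d₁ • S₁) + (6 * (d₁ : ℝ) - 4 * (d₂ : ℝ)) • (x₀ ^ d₂ • S₂)) 2 0) + ((((d₁ : ℝ)) • (x₀ ^ d₁ • S₁) + (6 * (d₁ : ℝ) - 4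
        * (d₂ : ℝ)) • (x₀ ^ d₂ • S₂)) 1 1 * (((d₁ : ℝ)) • (x₀ ^ d₁ • S₁) + (6 * (d₁ : ℝ) - 4 * (d₂ : ℝ)) • (x₀ ^ d₂ • S₂)) 2 2
        - (((d₁ : ℝ)) • (x₀ ^ d₁ • S₁) + (6 * (d₁ : ℝ) - 4 * (d₂ : ℝ)) • (x₀ ^ d₂ • S₂)) 1 2 * (((d₁ : ℝ)) • (x₀ ^ d₁ • S₁) + (6 * (d₁ : ℝ) - 4
        * (d₂ : ℝ)) • (x₀ ^ d₂ • S₂)) 2 1)) * L₂ + P₂)) * e2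
      - (3 * L₂ ^ 2 * (L₁ * L₃) * ((((d₁ : ℝ)) • (x₀ ^ d₁ • S₁) + (6 * (d₁ : ℝ) - 4 * (d₂ : ℝ)) • (x₀ ^ d₂ • S₂)).det * L₃)) * e1 - (3 * L₂ ^ 2
          * (L₁ * L₃) * P₁) * e3
    simp only [hL1, hL2, hL3, hP1, hP2, hP3]
    ring1
  have hnn : 0 ≤ (((((d₁ : ℝ)) • (x₀ ^ d₁ • S₁) + (6 * (d₁ : ℝ) - 4 * (d₂ : ℝ)) • (x₀ ^ d₂ • S₂)) 0 0 * (((d₁ : ℝ)) • (x₀ ^ d₁ • S₁) + (6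
      * (d₁ : ℝ) - 4 * (d₂ : ℝ)) • (x₀ ^ d₂ • S₂)) 1 1 - (((d₁ : ℝ)) • (x₀ ^ d₁ • S₁) + (6 * (d₁ : ℝ) - 4 * (d₂ : ℝ)) • (x₀ ^ d₂ • S₂)) 0 1
      * (((d₁ : ℝ)) • (x₀ ^ d₁ • S₁) + (6 * (d₁ : ℝ) - 4 * (d₂ : ℝ)) • (x₀ ^ d₂ • S₂)) 1 0 + ((((d₁ : ℝ)) • (x₀ ^ d₁ • S₁) + (6 * (d₁ : ℝ) - 4
      * (d₂ : ℝ)) • (x₀ ^ d₂ • S₂)) 0 0 * (((d₁ : ℝ)) • (x₀ ^ d₁ • S₁) + (6 * (d₁ : ℝ) - 4 * (d₂ : ℝ)) • (x₀ ^ d₂ • S₂)) 2 2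
      - (((d₁ : ℝ)) • (x₀ ^ d₁ • S₁) + (6 * (d₁ : ℝ) - 4 * (d₂ : ℝ)) • (x₀ ^ d₂ • S₂)) 0 2 * (((d₁ : ℝ)) • (x₀ ^ d₁ • S₁) + (6 * (d₁ : ℝ) - 4
      * (d₂ : ℝ)) • (x₀ ^ d₂ • S₂)) 2 0) + ((((d₁ : ℝ)) • (x₀ ^ d₁ • S₁) + (6 * (d₁ : ℝ) - 4 * (d₂ : ℝ)) • (x₀ ^ d₂ • S₂)) 1 1
      * (((d₁ : ℝ)) • (x₀ ^ d₁ • S₁) + (6 * (d₁ : ℝ) - 4 * (d₂ : ℝ)) • (x₀ ^ d₂ • S₂)) 2 2 - (((d₁ : ℝ)) • (x₀ ^ d₁ • S₁) + (6 * (d₁ : ℝ) - 4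
      * (d₂ : ℝ)) • (x₀ ^ d₂ • S₂)) 1 2 * (((d₁ : ℝ)) • (x₀ ^ d₁ • S₁) + (6 * (d₁ : ℝ) - 4 * (d₂ : ℝ)) • (x₀ ^ d₂ • S₂)) 2 1)) ^ 2
        - 3 * (((d₁ : ℝ)) • (x₀ ^ d₁ • S₁) + (6 * (d₁ : ℝ) - 4 * (d₂ : ℝ)) • (x₀ ^ d₂ • S₂)).trace * (((d₁ : ℝ)) • (x₀ ^ d₁ • S₁) + (6 * (d₁ : ℝ)
            - 4 * (d₂ : ℝ)) • (x₀ ^ d₂ • S₂)).det) * (L₁ * L₂ * L₃) ^ 2 :=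
    mul_nonneg (sub_nonneg.mpr hN) (sq_nonneg _)
  have hneg := mul_neg_of_pos_of_neg hLL hWneg
  rw [key] at hnn
  exact absurd hnn (not_le.mpr hneg)

end Summit.ValiantsHypothesis.ValiantsHypothesis.Theorems.LacunarySymmetroidMatrixDescartes.Census.ConfluentNine
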